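import Mathlib.Data.Fin.Tuple.Sort
import Summits.ValiantsHypothesis.ValiantsHypothesis.Theorems.KPlusLogSqLawTropicalBMergeClasses

/-!
# `TropicalB` — normal form of a design: `K = #exponents`, `0 = d₀ < d₁ < ⋯ < d_{K−1}`

HONEST FRAMING.  Helper toward the crux `Summit.ValiantsHypothesis.ValiantsHypothesis.Theses.KPlusLogSqLaw.TropicalB`
(ledger item `stmt-ValiantsHypothesis-19771`, route `KPlusLogSqLaw`, regime stubs `stub_tropThin` / `stub_tropFat` of
`Cruxes/TropicalB/Lines/birth.lean`; object-search cell `pub-symmetroid`, prover seat val-sym-trop-p3, 2026-08-26).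
Completes the MERGING normal form of `…TropicalBMergeClasses` (`exists_merged_chain`: `K` may be taken to be the number
of distinct exponents) by two trivial invariances of the dominance order, in the tree's vocabulary:

* `chain_relabel_classes` (`tropWeight_relabelClasses`, `termSign_relabelClasses`, `isDominant_relabelClasses`) — relabelling the slope classes by a permutation `π` of `Fin K` (design `(d ∘ π, v ∘ π, ε ∘ π)`,
  class maps `π⁻¹ ∘ λ`) preserves weights, signs and dominance;
* `tropWeight_translate` / `isDominant_translate` — translating all exponents by a constant `c` shifts every weight at
  slope `θ` by the same amount `θ·m·c`, so dominance is unchanged;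
* `exists_normalized_chain` — hence every sign-alternating dominant chain of a design of format `(m, K)` is, with the
  same slopes, permutations and signs, one of a design of format `(m, s)`, `s = #(image d) ≤ K`, whose exponent map is
  STRICTLY INCREASING with least exponent `0`;
* `tropKPlusLogSqLaw_iff_strictMono`, `tropRootLawAt_of_strictMono` — TB (`TropKPlusLogSqLaw`, δ-equal to the crux) and
  any row law monotone in `K` need only be proved for designs in this normal form (the paper convention
  `d = (0, d₁, …, d_{K−1})`, e.g. `(0, 1, D)` for the SHIFT-THREE family).

Nothing here bounds `T(m, K)` in the window `log₂ m + 1 < K < m`; nothing bears on `TropicalB`, `KPlusLogSqLaw`,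
`MatrixDescartes` or `VP ≠ VNP`. [folklore]
-/

-- `Summit.ValiantsHypothesis.ValiantsHypothesis.…` repeats a component by the D-0017 layout (single-conjunct summit),
-- which the `dupNamespace` linter flags; the namespace is mandated (same as the sibling `…TropicalKLaw*` modules).
set_option linter.dupNamespace false
set_option autoImplicit false

namespace Summit.ValiantsHypothesis.ValiantsHypothesis.Theorems.LacunarySymmetroidMatrixDescartes.TropicalCensus

open Summit.ValiantsHypothesis.ValiantsHypothesis.Theorems.MatrixDescartes.Negative
open scoped BigOperators
open Finset

variable {m K : ℕ}

/-! ## 1. Relabelling the slope classes -/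

/-- weights are invariant under relabelling the classes: the design `(d ∘ π, v ∘ π)` gives the term `(σ, π⁻¹ ∘ λ)` the
weight of `(σ, λ)`. [folklore] -/
theorem tropWeight_relabelClasses (π : Equiv.Perm (Fin K)) (d : Fin K → ℕ) (v : Fin m → Fin m → Fin K → ℤ) (θ : ℤ)
    (σ : Equiv.Perm (Fin m)) (κ : Fin m → Fin K) :
    tropWeight (d ∘ π) (fun a b l => v a b (π l)) θ (σ, κ) = tropWeight d v θ (σ, π ∘ κ) := by
  unfold tropWeight
  simp

/-- term signs are invariant under relabelling the classes. [folklore] -/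
theorem termSign_relabelClasses (π : Equiv.Perm (Fin K)) (ε : Fin m → Fin m → Fin K → ℤ)
    (σ : Equiv.Perm (Fin m)) (κ : Fin m → Fin K) :
    termSign (fun a b l => ε a b (π l)) (σ, κ) = termSign ε (σ, π ∘ κ) := by
  unfold termSign
  simp

/-- dominance is invariant under relabelling the classes. [folklore] -/
theorem isDominant_relabelClasses (π : Equiv.Perm (Fin K)) (d : Fin K → ℕ) (v ε : Fin m → Fin m → Fin K → ℤ) (θ : ℤ)
    (σ : Equiv.Perm (Fin m)) (μ : Fin m → Fin K) (h : IsDominant d v ε θ (σ, μ)) :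
    IsDominant (d ∘ π) (fun a b l => v a b (π l)) (fun a b l => ε a b (π l)) θ (σ, π.symm ∘ μ) := by
  refine ⟨?_, ?_⟩
  · rw [termSign_relabelClasses]
    have e : (π : Fin K → Fin K) ∘ (π.symm ∘ μ) = μ := by funext i; simp
    rw [e]; exact h.1
  · intro q hq hqs
    obtain ⟨σ', κ⟩ := q
    rw [termSign_relabelClasses] at hqs
    rw [tropWeight_relabelClasses, tropWeight_relabelClasses]
    have e : (π : Fin K → Fin K) ∘ (π.symm ∘ μ) = μ := by funext i; simp
    rw [e]
    refine h.2 (σ', π ∘ κ) ?_ hqs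
    intro hh
    apply hq
    have h1 : σ' = σ := congrArg Prod.fst hh
    have h2 : (π : Fin K → Fin K) ∘ κ = μ := congrArg Prod.snd hh
    refine Prod.ext h1 ?_
    show κ = π.symm ∘ μ
    rw [← h2]; funext i; simp

/-- **Relabelling the classes transports chains.**  A dominant chain `p` of `(d, v, ε)` is, with the same slopes,
permutations and term signs, the dominant chain `k ↦ (σₖ, π⁻¹ ∘ λₖ)` of the relabelled design `(d ∘ π, v ∘ π, ε ∘ π)`.
[folklore] -/
theorem chain_relabel_classes (π : Equiv.Perm (Fin K)) (d : Fin K → ℕ) (v ε : Fin m → Fin m → Fin K → ℤ) {n : ℕ}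
    (θ : Fin (n + 1) → ℤ) (p : Fin (n + 1) → Equiv.Perm (Fin m) × (Fin m → Fin K))
    (hdom : ∀ k, IsDominant d v ε (θ k) (p k)) :
    (∀ k, IsDominant (d ∘ π) (fun a b l => v a b (π l)) (fun a b l => ε a b (π l)) (θ k)
        ((p k).1, π.symm ∘ (p k).2)) ∧
    (∀ k, termSign (fun a b l => ε a b (π l)) ((p k).1, π.symm ∘ (p k).2) = termSign ε (p k)) := by
  refine ⟨fun k => isDominant_relabelClasses π d v ε (θ k) (p k).1 (p k).2 (hdom k), fun k => ?_⟩
  rw [termSign_relabelClasses]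
  have e : (π : Fin K → Fin K) ∘ (π.symm ∘ (p k).2) = (p k).2 := by funext i; simp
  rw [e]

/-! ## 2. Translating the exponents -/

/-- translating every exponent by `c` shifts the weight at slope `θ` by `θ·m·c`, the same for all terms. [folklore] -/
theorem tropWeight_translate (d : Fin K → ℕ) (c : ℕ) (v : Fin m → Fin m → Fin K → ℤ) (θ : ℤ)
    (q : Equiv.Perm (Fin m) × (Fin m → Fin K)) :
    tropWeight (fun l => d l + c) v θ q = tropWeight d v θ q + θ * (m * c) := by
  unfold tropWeight
  simp only [Nat.cast_add, sum_add_distrib, sum_const, card_univ, Fintype.card_fin]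
  ring

/-- dominance is invariant under translating the exponents. [folklore] -/
theorem isDominant_translate_iff (d : Fin K → ℕ) (c : ℕ) (v ε : Fin m → Fin m → Fin K → ℤ) (θ : ℤ)
    (q : Equiv.Perm (Fin m) × (Fin m → Fin K)) :
    IsDominant (fun l => d l + c) v ε θ q ↔ IsDominant d v ε θ q := by
  unfold IsDominant
  simp only [tropWeight_translate, add_lt_add_iff_right]

/-! ## 3. The normal form -/

/-- a monotone injective exponent map on `Fin s` is strictly monotone, and subtracting its least value keeps it so with
least value `0`. [folklore] -/
theorem strictMono_sub_of_monotone_injective {s : ℕ} (f : Fin s → ℕ) (hf : Monotone f) (hinj : Function.Injective f) :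
    StrictMono (fun t => f t - f ⟨0, Fin.pos t⟩) ∧ ∀ h : 0 < s, (fun t => f t - f ⟨0, Fin.pos t⟩) ⟨0, h⟩ = 0 := by
  have hsm : StrictMono f := hf.strictMono_of_injective hinj
  refine ⟨fun a b hab => ?_, fun h => by simp⟩
  have h0a : f ⟨0, Fin.pos a⟩ ≤ f a := hf (Fin.mk_le_of_le_val (Nat.zero_le _))
  have hlt : f a < f b := hsm hab
  have e : (⟨0, Fin.pos a⟩ : Fin s) = ⟨0, Fin.pos b⟩ := rfl
  simp only
  rw [e] at h0a ⊢
  omega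

/-- **NORMAL FORM.**  Every sign-alternating dominant chain of a design of format `(m, K)` (signs in `{−1, 0, 1}`) is,
with the same slopes, the same permutations and the same term signs, a dominant chain of a design of format `(m, s)`,
`s = #(image d)`, whose exponent map is STRICTLY INCREASING with least exponent `0` (merge the classes of equal exponent
— `exists_merged_chain` —, sort them — `Tuple.sort` —, and translate). [folklore] -/
theorem exists_normalized_chain (d : Fin K → ℕ) (v ε : Fin m → Fin m → Fin K → ℤ)
    (hε : ∀ i j l, (ε i j l).natAbs ≤ 1) {n : ℕ} (θ : Fin (n + 1) → ℤ)
    (p : Fin (n + 1) → Equiv.Perm (Fin m) × (Fin m → Fin K))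
    (hdom : ∀ k, IsDominant d v ε (θ k) (p k)) :
    ∃ (d' : Fin (univ.image d).card → ℕ) (v' ε' : Fin m → Fin m → Fin (univ.image d).card → ℤ)
      (p' : Fin (n + 1) → Equiv.Perm (Fin m) × (Fin m → Fin (univ.image d).card)),
      StrictMono d' ∧ (∀ h : 0 < (univ.image d).card, d' ⟨0, h⟩ = 0) ∧ (∀ i j t, (ε' i j t).natAbs ≤ 1) ∧
      (∀ k, (p' k).1 = (p k).1) ∧ (∀ k, termSign ε' (p' k) = termSign ε (p k)) ∧
      (∀ k, IsDominant d' v' ε' (θ k) (p' k)) := by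
  obtain ⟨d₁, v₁, ε₁, p₁, hinj, hε₁, hperm₁, hsign₁, hdom₁⟩ := exists_merged_chain d v ε hε θ p hdom
  -- sort the classes
  obtain ⟨π, hπ⟩ : ∃ π : Equiv.Perm (Fin (univ.image d).card), π = Tuple.sort d₁ := ⟨_, rfl⟩
  have hmono : Monotone (d₁ ∘ π) := by rw [hπ]; exact Tuple.monotone_sort d₁
  have hinj₂ : Function.Injective (d₁ ∘ π) := hinj.comp π.injective
  obtain ⟨hdom₂, hsign₂⟩ := chain_relabel_classes π d₁ v₁ ε₁ θ p₁ hdom₁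
  -- translate by the least exponent
  obtain ⟨hsm, hzero⟩ := strictMono_sub_of_monotone_injective (d₁ ∘ π) hmono hinj₂
  have hd₂eq : ∀ t, (d₁ ∘ π) t = ((d₁ ∘ π) t - (d₁ ∘ π) ⟨0, Fin.pos t⟩) + (d₁ ∘ π) ⟨0, Fin.pos t⟩ := by
    intro t
    have : (d₁ ∘ π) ⟨0, Fin.pos t⟩ ≤ (d₁ ∘ π) t := hmono (Fin.mk_le_of_le_val (Nat.zero_le _))
    omega
  refine ⟨fun t => (d₁ ∘ π) t - (d₁ ∘ π) ⟨0, Fin.pos t⟩, fun a b l => v₁ a b (π l), fun a b l => ε₁ a b (π l),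
    fun k => ((p₁ k).1, π.symm ∘ (p₁ k).2), hsm, hzero, fun i j t => hε₁ i j (π t), fun k => hperm₁ k,
    fun k => (hsign₂ k).trans (hsign₁ k), fun k => ?_⟩
  -- dominance survives the translation (all weights at `θ k` shift by the same amount)
  rcases Nat.eq_zero_or_pos (univ.image d).card with h0 | h0
  · -- no class: `Fin s` is empty, so the translated exponent map is the sorted one
    have e : (fun t : Fin (univ.image d).card => (d₁ ∘ π) t - (d₁ ∘ π) ⟨0, Fin.pos t⟩) = d₁ ∘ π := by
      funext t; exfalso; have := t.isLt; omega
    rw [e]; exact hdom₂ k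
  · have e : d₁ ∘ π = fun t => ((d₁ ∘ π) t - (d₁ ∘ π) ⟨0, Fin.pos t⟩) + (d₁ ∘ π) ⟨0, h0⟩ := by
      funext t; exact hd₂eq t
    have hk := hdom₂ k
    rw [e, isDominant_translate_iff] at hk
    exact hk

/-- **TB may assume the normal form.**  `TropKPlusLogSqLaw` (δ-equal to the crux `TropicalB`) is equivalent to its
restriction to designs with strictly increasing exponents and least exponent `0`. [folklore] -/
theorem tropKPlusLogSqLaw_iff_strictMono : TropKPlusLogSqLaw ↔
    ∃ C : ℕ, ∀ (m K : ℕ) (d : Fin K → ℕ), StrictMono d → (∀ h : 0 < K, d ⟨0, h⟩ = 0) →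
      ∀ (v ε : Fin m → Fin m → Fin K → ℤ) (n : ℕ) (θ : Fin (n + 1) → ℤ)
      (p : Fin (n + 1) → Equiv.Perm (Fin m) × (Fin m → Fin K)),
      (∀ i j l, (ε i j l).natAbs ≤ 1) → StrictMono θ → (∀ k, IsDominant d v ε (θ k) (p k)) →
      (∀ k : Fin n, termSign ε (p k.castSucc) * termSign ε (p k.succ) < 0) → n ≤ 2 ^ (C * (K + Nat.log 2 m ^ 2)) := by
  constructor
  · rintro ⟨C, hC⟩
    exact ⟨C, fun m K d _ _ v ε n θ p hε hθ hdom halt => hC m K d v ε n θ p hε hθ hdom halt⟩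
  · rintro ⟨C, hC⟩
    refine ⟨C, fun m K d v ε n θ p hε hθ hdom halt => ?_⟩
    obtain ⟨d', v', ε', p', hsm, hz, hε', _, hsign, hdom'⟩ := exists_normalized_chain d v ε hε θ p hdom
    have hn := hC m (univ.image d).card d' hsm hz v' ε' n θ p' hε' hθ hdom'
      (fun k => by rw [hsign, hsign]; exact halt k)
    refine hn.trans (Nat.pow_le_pow_right (by norm_num) (Nat.mul_le_mul_left _ ?_))
    exact Nat.add_le_add_right (card_image_exponents_le d) _

/-- The same reduction for any row law monotone in `K` (e.g. the two regime stubs' shapes): it holds for all designs as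
soon as it holds for designs in normal form. [folklore] -/
theorem tropRootLawAt_of_strictMono (F : ℕ → ℕ → ℕ) (hF : ∀ m, Monotone (F m))
    (h : ∀ (m K : ℕ) (d : Fin K → ℕ), StrictMono d → (∀ h : 0 < K, d ⟨0, h⟩ = 0) →
      ∀ (v ε : Fin m → Fin m → Fin K → ℤ) (n : ℕ) (θ : Fin (n + 1) → ℤ)
      (p : Fin (n + 1) → Equiv.Perm (Fin m) × (Fin m → Fin K)),
      (∀ i j l, (ε i j l).natAbs ≤ 1) → StrictMono θ → (∀ k, IsDominant d v ε (θ k) (p k)) →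
      (∀ k : Fin n, termSign ε (p k.castSucc) * termSign ε (p k.succ) < 0) → n ≤ F m K)
    (m K : ℕ) : TropRootLawAt m K (F m K) := by
  intro d v ε n θ p hε hθ hdom halt
  obtain ⟨d', v', ε', p', hsm, hz, hε', _, hsign, hdom'⟩ := exists_normalized_chain d v ε hε θ p hdom
  have hn := h m (univ.image d).card d' hsm hz v' ε' n θ p' hε' hθ hdom'
    (fun k => by rw [hsign, hsign]; exact halt k)
  exact hn.trans (hF m (card_image_exponents_le d))

end Summit.ValiantsHypothesis.ValiantsHypothesis.Theorems.LacunarySymmetroidMatrixDescartes.TropicalCensus
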